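import Mathlib
import HarnessLib
import Summits.FinalStateConjecture.FinalStateConjecture.Theses.SwallowTheDatum
import Literature.Geometry.Lorentzian.HintzGluedEMRIData
import Literature.Geometry.Lorentzian.KerrData
import Literature.Geometry.Lorentzian.InitialDataPullback

/-!
# Sketch — first lemmas of three crux ideas for `SwallowTheDatum.ParametricKerrBurial`
(planner crux-ideate, ideator 3, round 1). Nothing here is proved; every `def … : Prop` must
elaborate. Namespace is scratch.

* `IsBentKerrShielded X D` — the crux's shielding block, verbatim (exact bent Kerr–Schild/BL slice
  of sub-extremal Kerr outside a compact set, junction radius `r₁ ∈ (r₋, r₊)`).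
* Card `universal-coffin-mass-jump`: `HasSchwarzschildFloor`, `HasBentKerrLid`, `UniversalCoffin`.
* Card `zero-killing-charge-insertion`: `ZeroKillingChargeVelocity`, `ZeroChargeInteriorGluing`.
* Card `trapped-target-null-gluing`: `CompactlyFrozenShielding`.
-/

noncomputable section

open scoped Manifold ContDiff Topology
open Set Literature.Geometry.Lorentzian

namespace Summit.FinalStateConjecture.FinalStateConjecture.Cruxes.ParametricKerrBurial.Sketch

/-- The crux's shielding predicate for a datum `D` on `X` (verbatim body of the `∀ c ≠ 0` clause of
`SwallowTheDatum.ParametricKerrBurial`). -/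
def IsBentKerrShielded [Kerr.Facts] (X : Type) [TopologicalSpace X] [ChartedSpace E3 X]
    [IsManifold (𝓡 3) ((⊤ : ℕ∞) : WithTop ℕ∞) X] (D : InitialDataSet (𝓡 3) X) : Prop :=
  ∃ (M a r₁ : ℝ) (hM : 0 ≤ M) (T : ℝ → ℝ) (φ : Kerr.slice a r₁ → X)
    (ψ : Kerr.slice a r₁ → Kerr.region a r₁) (ν : NormalField 𝓘(ℝ, E4) ψ),
    |a| < M ∧ Kerr.rMinus M a < r₁ ∧ r₁ < Kerr.rPlus M a ∧
    T = (fun r : ℝ => Real.smoothTransition (r / (4 * M) - 1) *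
      (((M) / Real.sqrt ((M) ^ 2 - (a) ^ 2)) *
        (Kerr.rPlus M a * Real.log (r - Kerr.rPlus M a) - Kerr.rMinus M a * Real.log (r - Kerr.rMinus M a)) -
       ((M) / Real.sqrt ((M) ^ 2 - (a) ^ 2)) *
        (Kerr.rPlus M a * Real.log ((4 * M) - Kerr.rPlus M a) -
          Kerr.rMinus M a * Real.log ((4 * M) - Kerr.rMinus M a)))) ∧
    IsCompact (Set.range φ)ᶜ ∧ Topology.IsOpenEmbedding φ ∧
    ContMDiff 𝓘(ℝ, E3) (𝓡 3) ((⊤ : ℕ∞) : WithTop ℕ∞) φ ∧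
    (∀ y : Kerr.slice a r₁, (ψ y : E4) =
      E4.ofTimeSpace (T (Kerr.radius a (E4.ofTimeSpace 0 (y : E3)))) (y : E3)) ∧
    (Kerr.smoothMetric M a r₁).IsSpacelikeImmersion 𝓘(ℝ, E3) ψ ∧
    (Kerr.smoothMetric M a r₁).IsFutureUnitNormal 𝓘(ℝ, E3)
      ((Kerr.timeOrientation M a r₁ hM).ofLE le_top) ψ ν ∧
    (∀ y : Kerr.slice a r₁,
      pullbackBilin (I := 𝓡 3) (I' := 𝓘(ℝ, E3)) φ D.h.inner y =
        pullbackBilin (I := 𝓘(ℝ, E4)) (I' := 𝓘(ℝ, E3)) ψ (Kerr.smoothMetric M a r₁).val y) ∧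
    (∀ [(Kerr.smoothMetric M a r₁).HasLeviCivita] (y : Kerr.slice a r₁),
      (pullbackBilin (I := 𝓡 3) (I' := 𝓘(ℝ, E3)) φ D.k y).toLinearMap₁₂ =
        (Kerr.smoothMetric M a r₁).secondFundamentalForm 𝓘(ℝ, E3) ψ ν y)

/-! ### Card `trapped-target-null-gluing` — first lemma -/

/-- **Compactly frozen shielding** (single-datum core of the characteristic line; the family is
obtained by running it with a moving radius): every admissible datum can be shielded WITHOUT
changing it on a prescribed compact set. -/
def CompactlyFrozenShielding : Prop :=
  ∀ [Kerr.Facts] (X : Type) [TopologicalSpace X] [ChartedSpace E3 X]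
    [IsManifold (𝓡 3) ((⊤ : ℕ∞) : WithTop ℕ∞) X] [T2Space X] [SecondCountableTopology X]
    [ConnectedSpace X],
    ∀ d ∈ admissibleVacuumData X, ∀ K : Set X, IsCompact K →
      ∃ d' ∈ admissibleVacuumData X,
        (∀ x ∈ K, d'.h.inner x = d.h.inner x ∧ d'.k x = d.k x) ∧ IsBentKerrShielded X d'

/-! ### Card `universal-coffin-mass-jump` — first lemma -/

/-- The coffin's **massive floor**: on `{ρ < ‖y‖ < 2ρ}` the datum IS the Kerr–Schild slice datum
of Schwarzschild of mass `μ` (`Kerr.data μ 0 ρ`). -/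
def HasSchwarzschildFloor [Kerr.Facts] [Kerr.SliceFacts] (μ ρ : ℝ) (hμ : 0 ≤ μ)
    (W : InitialDataSet 𝓘(ℝ, E3) (Kerr.slice 0 ρ)) : Prop :=
  ∀ y : Kerr.slice 0 ρ, ‖(y : E3)‖ < 2 * ρ →
    W.h.inner y = (Kerr.data μ 0 ρ hμ).h.inner y ∧ W.k y = (Kerr.data μ 0 ρ hμ).k y

/-- The coffin's **lid**: the crux's shielding block on the carrier `Kerr.slice 0 ρ = {‖y‖ > ρ}`,
with "compact complement of the exact region" replaced by "the exact region contains
`{‖y‖ > R'}`" (the carrier is not complete at `‖y‖ = ρ`). -/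
def HasBentKerrLid [Kerr.Facts] (ρ : ℝ) (W : InitialDataSet 𝓘(ℝ, E3) (Kerr.slice 0 ρ)) : Prop :=
  ∃ (M a r₁ : ℝ) (hM : 0 ≤ M) (T : ℝ → ℝ) (φ : Kerr.slice a r₁ → Kerr.slice 0 ρ)
    (ψ : Kerr.slice a r₁ → Kerr.region a r₁) (ν : NormalField 𝓘(ℝ, E4) ψ),
    |a| < M ∧ Kerr.rMinus M a < r₁ ∧ r₁ < Kerr.rPlus M a ∧
    T = (fun r : ℝ => Real.smoothTransition (r / (4 * M) - 1) *
      (((M) / Real.sqrt ((M) ^ 2 - (a) ^ 2)) *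
        (Kerr.rPlus M a * Real.log (r - Kerr.rPlus M a) - Kerr.rMinus M a * Real.log (r - Kerr.rMinus M a)) -
       ((M) / Real.sqrt ((M) ^ 2 - (a) ^ 2)) *
        (Kerr.rPlus M a * Real.log ((4 * M) - Kerr.rPlus M a) -
          Kerr.rMinus M a * Real.log ((4 * M) - Kerr.rMinus M a)))) ∧
    (∃ R' : ℝ, ∀ y : Kerr.slice 0 ρ, R' < ‖(y : E3)‖ → y ∈ Set.range φ) ∧
    Topology.IsOpenEmbedding φ ∧
    ContMDiff 𝓘(ℝ, E3) 𝓘(ℝ, E3) ((⊤ : ℕ∞) : WithTop ℕ∞) φ ∧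
    (∀ y : Kerr.slice a r₁, (ψ y : E4) =
      E4.ofTimeSpace (T (Kerr.radius a (E4.ofTimeSpace 0 (y : E3)))) (y : E3)) ∧
    (Kerr.smoothMetric M a r₁).IsSpacelikeImmersion 𝓘(ℝ, E3) ψ ∧
    (Kerr.smoothMetric M a r₁).IsFutureUnitNormal 𝓘(ℝ, E3)
      ((Kerr.timeOrientation M a r₁ hM).ofLE le_top) ψ ν ∧
    (∀ y : Kerr.slice a r₁,
      pullbackBilin (I := 𝓘(ℝ, E3)) (I' := 𝓘(ℝ, E3)) φ W.h.inner y =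
        pullbackBilin (I := 𝓘(ℝ, E4)) (I' := 𝓘(ℝ, E3)) ψ (Kerr.smoothMetric M a r₁).val y) ∧
    (∀ [(Kerr.smoothMetric M a r₁).HasLeviCivita] (y : Kerr.slice a r₁),
      (pullbackBilin (I := 𝓘(ℝ, E3)) (I' := 𝓘(ℝ, E3)) φ W.k y).toLinearMap₁₂ =
        (Kerr.smoothMetric M a r₁).secondFundamentalForm 𝓘(ℝ, E3) ψ ν y)

/-- **Universal coffin** (K1 of card `universal-coffin-mass-jump`): for every floor ratio `ε > 0`
there is ONE smooth vacuum datum on `{‖y‖ > ρ}` which is exactly the Schwarzschild(`μ`) slice on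
the floor annulus `{ρ < ‖y‖ < 2ρ}`, `0 < μ < ερ`, and exactly the bent Kerr–Schild/BL slice of a
sub-extremal Kerr outside a bounded set, junction radius inside the horizons. The datum is
`d`-independent; burial of any `d` is then MOT far-field mass-jump gluing + dilation. -/
def UniversalCoffin : Prop :=
  ∀ [Kerr.Facts] [Kerr.SliceFacts], ∀ ε : ℝ, 0 < ε →
    ∃ (μ ρ : ℝ) (hμ : 0 < μ) (W : InitialDataSet 𝓘(ℝ, E3) (Kerr.slice 0 ρ)),
      μ < ε * ρ ∧
      (∀ [W.metric.HasLeviCivita], W.IsVacuumConstraintSolution) ∧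
      HasSchwarzschildFloor μ ρ hμ.le W ∧ HasBentKerrLid ρ W

/-! ### Card `zero-killing-charge-insertion` — first lemmas -/

/-- **Zero-Killing-charge 4-velocities exist strictly between the horizons**: at every point of
the ingoing Kerr–Schild chart with `r₋ < r < r₊` there is a future unit timelike vector orthogonal
to BOTH Killing fields `∂_{t*}` and `∂_φ = x₁∂₂ − x₂∂₁` (the span of the Killing fields is a
spacelike 2-plane there: Gram determinant `−Δ sin²θ > 0`). Pure Kerr–Schild algebra. -/
def ZeroKillingChargeVelocity : Prop :=
  ∀ (M a : ℝ), Kerr.IsSubextremal M a → ∀ x : E4,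
    Kerr.rMinus M a < Kerr.radius a x → Kerr.radius a x < Kerr.rPlus M a →
      ∃ u : E4, Kerr.bilin M a x u u = -1 ∧
        Kerr.bilin M a x u (Kerr.timeVector M a x) < 0 ∧
        Kerr.bilin M a x u (E4.basisVector 0) = 0 ∧
        Kerr.bilin M a x u ((x 1) • E4.basisVector 2 - (x 2) • E4.basisVector 1) = 0

/-- **Zero-charge interior gluing** (K1 of card `zero-killing-charge-insertion`): Hintz's glued
families exist, as GENUINE vacuum data equal to the background outside a compact set lying
strictly inside the black hole, when the background `D₀` (any admissible datum on `E3` which is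
exact Kerr on `W ⊇ Kᶜ`, read through `Kerr.EmbeddedPatch` — any slicing) is glued at a point `p`
STRICTLY BETWEEN THE HORIZONS and the small body's 4-velocity `u` (determined by the boost `Λ` of
the model's far patch, the frame `L` and the patch normal, exactly as in
`IsHintzGluedEMRIFamily`) is orthogonal to both Kerr Killing fields at `p` (zero Killing energy,
zero axial Killing angular momentum). Compare `Kerr.hintz2022_kerrSliceGluing` (exterior `p`,
violations inside the hole) — here no constraint violation anywhere and no KID-free set. -/
def ZeroChargeInteriorGluing : Prop :=
  ∀ [Kerr.Facts] [Kerr.SliceFacts] (M a : ℝ) (hMa : Kerr.IsSubextremal M a) (r₁ : ℝ)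
    (D₀ : InitialDataSet (𝓡 3) E3) (W : TopologicalSpace.Opens E3) (p : E3) (hp : p ∈ W)
    (P : Kerr.EmbeddedPatch M a r₁ hMa.pos.le D₀ W) (K : Set E3),
    -- genuinely rotating lid: exactly two Killing fields (for `a = 0` the three extra rotations
    -- force a radial zero-energy boost and an orientation condition on the body's spin; not claimed)
    a ≠ 0 →
    D₀ ∈ admissibleVacuumData E3 → IsCompact K → Kᶜ ⊆ (W : Set E3) → p ∉ K →
    -- insertion point strictly between the horizons and off the rotation axis
    Kerr.rMinus M a < Kerr.radius a (P.embed ⟨p, hp⟩ : E4) →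
    Kerr.radius a (P.embed ⟨p, hp⟩ : E4) < Kerr.rPlus M a →
    ¬ ((P.embed ⟨p, hp⟩ : E4) 1 = 0 ∧ (P.embed ⟨p, hp⟩ : E4) 2 = 0) →
    ∀ (m â rc R : ℝ) (hm : Kerr.IsSubextremal m â) (Λ : lorentzGroup)
      (Dhat : InitialDataSet (𝓡 3) E3),
      Nonempty (Kerr.BoostedFarPatch m â rc hm.pos.le Λ R Dhat) →
      (∀ [Dhat.metric.HasLeviCivita], Dhat.IsVacuumConstraintSolution) →
    ∀ (L : E3 →L[ℝ] E3), (∀ v w : E3, D₀.h.inner p (L v) (L w) = inner ℝ v w) →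
      0 < (Λ : E4 ≃L[ℝ] E4) (E4.basisVector 0) 0 →
    ∀ u : E4,
      u = ((Λ : E4 ≃L[ℝ] E4) (E4.basisVector 0) 0) • (show E4 from P.normal ⟨p, hp⟩) +
        (show E3 →L[ℝ] E4 from mfderiv (𝓡 3) 𝓘(ℝ, E4) P.embed ⟨p, hp⟩)
          (L (E4.spatial ((Λ : E4 ≃L[ℝ] E4) (E4.basisVector 0)))) →
      -- ZERO KILLING CHARGES at the insertion point
      Kerr.bilin M a (P.embed ⟨p, hp⟩ : E4) u (E4.basisVector 0) = 0 →
      Kerr.bilin M a (P.embed ⟨p, hp⟩ : E4) u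
        (((P.embed ⟨p, hp⟩ : E4) 1) • E4.basisVector 2 - ((P.embed ⟨p, hp⟩ : E4) 2) • E4.basisVector 1) = 0 →
    ∃ (ε₀ : ℝ) (D : ℝ → InitialDataSet (𝓡 3) E3),
      HintzGluing.IsGluedFamily D₀ p L Dhat ε₀ D ∧
      (∀ ε ∈ Ioo 0 ε₀, D ε ∈ admissibleVacuumData E3) ∧
      ∃ rstar : ℝ, rstar < Kerr.rPlus M a ∧ ∀ ε ∈ Ioo 0 ε₀, ∀ y : W,
        rstar ≤ Kerr.radius a (P.embed y : E4) →
          (D ε).h.inner (y : E3) = D₀.h.inner (y : E3) ∧ (D ε).k (y : E3) = D₀.k (y : E3)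

end Summit.FinalStateConjecture.FinalStateConjecture.Cruxes.ParametricKerrBurial.Sketch

end
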